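import Literature.FieldTheory.Separability.PIndependentDerivations
import Literature.FieldTheory.Separability.PDegreeSeparablyGenerated
import Mathlib.RingTheory.Kaehler.Basic
import Mathlib.RingTheory.IntegralClosure.IntegrallyClosed
import Mathlib.RingTheory.Localization.FractionRing
import HarnessLib

/-!
# The kernel of `d : K → Ω[K⁄k]` in characteristic `p` is `K^p(k)` (Matsumura §26; Shimura §2.8 Prop. 6 (i))

Topic `Literature/FieldTheory/Separability`, namespace `Literature.FieldTheory.Separability`.
Theorems only (no definition, no named fact; net Literature debt 0).  Cell `hodgecm-mathlib` (D-0151),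
fan A rung A-II (h21), EDITION E2 «height-one road» for the degree-one Shimura–Taniyama congruence
(`shimuraTaniyamaPair_degOne`, A-p02 memo `ROAD-E2-heightOne-S2degOne.md`, piece HO-alg in field form).

For a field extension `K ⊇ k` of characteristic `p`:

* `kaehlerDifferential_D_eq_zero_iff_mem_pAdjoin` — **`d a = 0` in `Ω[K⁄k]` if and only if
  `a ∈ K^p(k)`** (the subfield generated by the `p`-th powers and the image of `k`).  «⇐» because a
  derivation kills `p`-th powers and scalars; «⇒» because for `a ∉ F ⊇ K^p` there is a derivation `D` of `K`
  with `D a = 1` vanishing on `F` (`exists_derivation_eq_one_eqOn_zero`, Matsumura §26 p. 202), which is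
  `k`-linear when `F ⊇ k`, so that it factors through `Ω[K⁄k]`.
  [Matsumura, *Commutative Ring Theory*, §26, Thm. 26.5 and p. 202; Shimura, *Abelian Varieties with
  Complex Multiplication*, §2.8 Prop. 6 (i): «`δλ = 0` if and only if `k(λx) ⊂ k(x^p)`», whose field-theoretic
  core is `{f : df = 0} = k(A)^p · k`.]
* `exists_pow_eq_of_kaehlerDifferential_D_eq_zero` — over a PERFECT `k`, `K^p(k) = K^p`, so `d a = 0`
  forces `a = b^p`.
* `exists_pow_eq_of_kaehlerDifferential_D_eq_zero_of_isIntegrallyClosed` — the same for an element of an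
  integrally closed domain `R` over a perfect field (`d x = 0` in `Ω[R⁄k]` ⇒ `x = y^p` with `y ∈ R`): pass
  to `Frac R` and use that `y` is a root of the monic `X^p − x`.

## References

* [Matsumura1987] H. Matsumura, *Commutative Ring Theory*, CUP 1986, §26 (p. 202, Thm. 26.5).
* [Shimura1998] G. Shimura, *Abelian Varieties with Complex Multiplication and Modular Functions*,
  Princeton 1998, §2.8, Lemma 2 and Prop. 6 (i) (pp. 23–26).
-/

noncomputable section

namespace Literature.FieldTheory.Separability

variable {k K : Type*} [Field k] [Field K] [Algebra k K] (p : ℕ) [Fact p.Prime] [CharP K p]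

/-- **The kernel of `d : K → Ω[K⁄k]` is `K^p(k)`** (`p = char K`): `d a = 0` if and only if `a` lies in
the subfield generated by the `p`-th powers of `K` and the image of `k` (Matsumura §26, Thm. 26.5 and
p. 202; the field-theoretic content of Shimura §2.8 Prop. 6 (i)). [cite: Matsumura1987, §26 Thm. 26.5 and p. 202]
[cite: Shimura1998, §2.8 Prop. 6 (i)] -/
theorem kaehlerDifferential_D_eq_zero_iff_mem_pAdjoin (a : K) :
    KaehlerDifferential.D k K a = 0 ↔ a ∈ pAdjoin p (Set.range (algebraMap k K)) := by
  haveI : ExpChar K p := ExpChar.prime Fact.out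
  constructor
  · intro ha
    by_contra hmem
    -- a derivation `D` of `K` with `D a = 1` vanishing on `F := K^p(k)`
    obtain ⟨D, hDa, hDF⟩ := exists_derivation_eq_one_eqOn_zero p (pAdjoin p (Set.range (algebraMap k K)))
      (fun x => pow_mem_pAdjoin _ x) hmem
    have hDk : ∀ c : k, D (algebraMap k K c) = 0 :=
      fun c => hDF _ (subset_pAdjoin _ ⟨c, rfl⟩)
    -- it is `k`-linear (it kills `k`), so it factors through `Ω[K⁄k]`, where `d a = 0`
    let D' : Derivation k K K :=
      { toFun := D
        map_add' := map_add D
        map_smul' := fun c x => by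
          rw [Algebra.smul_def, Derivation.leibniz, hDk c, smul_zero, add_zero, RingHom.id_apply,
            ← algebraMap_smul K c (D x), Algebra.algebraMap_eq_smul_one, smul_assoc, one_smul]
        map_one_eq_zero' := D.map_one_eq_zero
        leibniz' := D.leibniz }
    have h := D'.liftKaehlerDifferential_comp_D a
    rw [ha, map_zero] at h
    exact zero_ne_one (h.trans hDa)
  · intro ha
    -- `d` vanishes on `p`-th powers and on `k`, hence on the subfield they generate
    have h := Derivation.eqOn_subfieldClosure
      (D₁ := (KaehlerDifferential.D k K).restrictScalars ℤ) (D₂ := 0)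
      (s := Set.range (frobenius K p) ∪ Set.range (algebraMap k K)) ?_
    · exact h ha
    · rintro x (⟨y, rfl⟩ | ⟨c, rfl⟩)
      · change KaehlerDifferential.D k K (frobenius K p y) = (0 : Derivation ℤ K (Ω[K⁄k])) _
        rw [frobenius_def, Derivation.zero_apply]
        exact Derivation.apply_pow_char (p := p) ((KaehlerDifferential.D k K).restrictScalars ℤ) y
      · change KaehlerDifferential.D k K (algebraMap k K c) = (0 : Derivation ℤ K (Ω[K⁄k])) _
        rw [Derivation.zero_apply, Derivation.map_algebraMap]

/-- Over a perfect ground field the subfield `K^p(k)` is `K^p` (Matsumura §26 p. 203).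
[cite: Matsumura1987, §26 p. 203] -/
theorem pAdjoin_range_algebraMap_eq_fieldRange_frobenius [PerfectField k] :
    pAdjoin p (Set.range (algebraMap k K)) = (frobenius K p).fieldRange := by
  haveI : ExpChar K p := ExpChar.prime Fact.out
  apply le_antisymm
  · refine (Subfield.closure_le).mpr ?_
    rintro x (⟨y, rfl⟩ | ⟨c, rfl⟩)
    · exact RingHom.mem_fieldRange.mpr ⟨y, rfl⟩
    · exact algebraMap_mem_frobenius_fieldRange p c
  · rintro x ⟨y, rfl⟩
    exact pow_mem_pAdjoin _ y

/-- **`d a = 0` forces `a` to be a `p`-th power** when the ground field is perfect: the kernel of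
`d : K → Ω[K⁄k]` is `K^p(k) = K^p` (Matsumura §26, Thm. 26.5 and p. 203; Shimura §2.8 Prop. 6 (i) with
`k` perfect). [cite: Matsumura1987, §26 Thm. 26.5, pp. 202–203] [cite: Shimura1998, §2.8 Prop. 6 (i)] -/
theorem exists_pow_eq_of_kaehlerDifferential_D_eq_zero [PerfectField k] (a : K)
    (ha : KaehlerDifferential.D k K a = 0) : ∃ b : K, b ^ p = a := by
  have h := (kaehlerDifferential_D_eq_zero_iff_mem_pAdjoin p a).mp ha
  rw [pAdjoin_range_algebraMap_eq_fieldRange_frobenius p] at h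
  obtain ⟨b, hb⟩ := RingHom.mem_fieldRange.mp h
  exact ⟨b, hb⟩

omit [Fact p.Prime] in
/-- Conversely a `p`-th power has zero differential (`d(b^p) = p b^{p-1} db = 0`; Matsumura §26 p. 202,
the inclusion `K^p ⊆ ker d`). [cite: Matsumura1987, §26 p. 202] -/
theorem kaehlerDifferential_D_pow_char (b : K) : KaehlerDifferential.D k K (b ^ p) = 0 :=
  Derivation.apply_pow_char (p := p) ((KaehlerDifferential.D k K).restrictScalars ℤ) b

/-- Over a perfect ground field: `d a = 0` in `Ω[K⁄k]` **iff** `a` is a `p`-th power.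
[cite: Matsumura1987, §26 Thm. 26.5, pp. 202–203] -/
theorem kaehlerDifferential_D_eq_zero_iff_exists_pow_eq [PerfectField k] (a : K) :
    KaehlerDifferential.D k K a = 0 ↔ ∃ b : K, b ^ p = a := by
  refine ⟨exists_pow_eq_of_kaehlerDifferential_D_eq_zero p a, ?_⟩
  rintro ⟨b, rfl⟩
  exact kaehlerDifferential_D_pow_char p b

/-- **Integrally closed domains over a perfect field**: if `x ∈ R` has `d x = 0` in `Ω[R⁄k]`, then
`x = y^p` for some `y ∈ R` — pass to the fraction field (`d` commutes with localisation), take the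
`p`-th root there, and note that it is a root of the monic `X^p − x`, hence lies in `R`.  This is the
form in which the statement is used on the affine rings / local rings of a smooth variety.
[cite: Matsumura1987, §26 Thm. 26.5, pp. 202–203] -/
theorem exists_pow_eq_of_kaehlerDifferential_D_eq_zero_of_isIntegrallyClosed [PerfectField k]
    {R : Type*} [CommRing R] [IsDomain R] [IsIntegrallyClosed R] [Algebra k R] [CharP R p] (x : R)
    (hx : KaehlerDifferential.D k R x = 0) : ∃ y : R, y ^ p = x := by
  let L := FractionRing R
  haveI : CharP L p := charP_of_injective_algebraMap (IsFractionRing.injective R L) p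
  have hL : KaehlerDifferential.D k L (algebraMap R L x) = 0 := by
    rw [← KaehlerDifferential.map_D k k R L x, hx, map_zero]
  obtain ⟨b, hb⟩ := exists_pow_eq_of_kaehlerDifferential_D_eq_zero p (algebraMap R L x) hL
  -- `b` is integral over `R` (a root of `X^p - x`), hence in `R`
  have hint : IsIntegral R b := by
    refine ⟨Polynomial.X ^ p - Polynomial.C x, Polynomial.monic_X_pow_sub_C x (Fact.out : p.Prime).ne_zero, ?_⟩
    simp [hb]
  obtain ⟨y, hy⟩ := IsIntegrallyClosed.isIntegral_iff.mp hint
  refine ⟨y, IsFractionRing.injective R L ?_⟩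
  rw [map_pow, hy, hb]

end Literature.FieldTheory.Separability

end
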